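import Mathlib
import Summits.NavierStokesRegularity.NavierStokesRegularity.Theorems.LerayQuarterDissipationFiniteDissipationLiouvilleVorticityLThree
import Summits.NavierStokesRegularity.NavierStokesRegularity.Theorems.LerayQuarterDissipationFiniteDissipationLiouvilleVorticityAmplitudeWindows
import HarnessLib

/-!
# Crux `FiniteDissipationLiouville` (stmt-NavierStokesRegularity-22144): the `L³`-vorticity of a
# singular member reaches `√3/KS` (scale-invariantly) in EVERY long backward log-window, hence near
# the apex and in the far past — with NO compactness constant

Theorems file of route `LerayQuarterDissipation` (lead prover g16; `--supports` the crux; portrait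
fact for the registered stub `stub_envelopeCriticalLiouville` of skeleton `Lines/birth.lean`; the
window form of `…VorticityLThree`, on the pattern of lead g15's `…VorticityAmplitudeWindows`).
Navier–Stokes regularity is NOT proved by anything here; no summit is.

`𝒟_{C,K}`: Type-I ancient mild fields `u` (KNSS gauge, `IsTypeIAncientMild C u`) with the
quarter-rate law `∫‖Du(t)‖² ≤ K/√(−t)`; `KS = SNormLESNormFDerivOfEqConst ℝ³ volume 2` (Mathlib's
Gagliardo–Nirenberg–Sobolev constant). `…VorticityLThree.not_singular_of_vorticityLThree_lt`: no
singular member has `∫⁻‖curl u(t)‖ₑ³ ≤ v³/(√(−t))³` for ALL `t < 0` when `KS²v² < 3`. Because the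
`L³` law is a CLOSED condition preserved under the KNSS limits of the class (Fatou) while the
smallness sits on the parameter `v`, the window upgrade needs no threshold/collar theorem and no
compactness constant:

* `cubeLaw_nsRescale` — the `L³`-vorticity law is scale invariant
  (`∫⁻‖curl u_c(s)‖ₑ³ = c³∫⁻‖curl u(c²s)‖ₑ³`);
* `notSingular_of_vorticityLThree_le_windows` — if `u ∈ 𝒟_{C,K}`, `v ≥ 0`, `KS²v² < 3`, and for
  every `Λ > 1` some backward window `[Λ²τ, τ/Λ²]` (`τ < 0`) carries the law
  `∫⁻‖curl u(t)‖ₑ³ ≤ v³/(√(−t))³` for all its `t`, then `u` is bounded at the apex (orbit limit along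
  the window scales: `Compactness.seqLimit` on the rescalings `u_{√(−τ_k)}`, law by
  `law_of_seqLimit`, the `L³` law for ALL `t` by the pointwise convergence of the gradients and
  FATOU (`lintegral_liminf_le'`), singular by persistence: excluded by the rung);
* `vorticityLThree_exceeds_windows_of_singular` — contrapositive: **a SINGULAR member admits a
  window length `Λ` such that every backward window `[Λ²τ, τ/Λ²]` contains an instant with
  `(√(−t))³∫‖curl u(t)‖³ > v³`**, for every `v ≥ 0` with `KS²v² < 3`;
* `vorticityLThree_exceeds_farPast_of_singular`, `vorticityLThree_exceeds_nearApex_of_singular` —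
  hence `limsup_{t→−∞} √(−t)‖ω(t)‖_{L³} ≥ √3/KS` and `limsup_{t→0⁻} √(−t)‖ω(t)‖_{L³} ≥ √3/KS` on every
  singular member of the stratum — EXPLICIT, unlike the velocity/vorticity-amplitude window floors
  whose collars `ε(C,K)` come from compactness.

HONEST FRAMING. A portrait clause of the hypothetical singular profile with Mathlib's non-sharp
Sobolev constant; nothing is removed from the catalogued DSS wall (`TypeIDSSLiouville`, NECESSARY for
the crux); nothing here bears on Navier–Stokes regularity or blow-up.

References: Koch–Nadirashvili–Seregin–Šverák, Acta Math. 203 (2009) §4 (compactness of the class);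
folklore.
-/

noncomputable section

set_option linter.dupNamespace false

namespace Summit.NavierStokesRegularity.NavierStokesRegularity.Theorems.FiniteDissipationLiouville.VorticityLThree

open MeasureTheory Set Filter Topology Metric Function Real
open scoped ENNReal
open Literature.Analysis Literature.Analysis.FluidPDE
open Summit.NavierStokesRegularity.NavierStokesRegularity.Theorems
open Summit.NavierStokesRegularity.NavierStokesRegularity.Theorems.FiniteDissipationLiouville

/-! ### Scale invariance of the `L³`-vorticity law under `nsRescale` -/

/-- **`∫⁻‖curl u_c(s)‖ₑ³ = c³ ∫⁻‖curl u(c²s)‖ₑ³`** for `c > 0`: `curl u_c(s)(x) = c²·curl u(c²s)(cx)`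
(`QuietVorticity.curl_nsRescale`) and the substitution `y = cx` costs `c⁻³`
(`PoincareBall.lintegral_comp_smul_add`). [folklore] -/
theorem lintegral_curl_nsRescale_cube {c : ℝ} (hc : 0 < c)
    (u : ℝ → EuclideanSpace ℝ (Fin 3) → EuclideanSpace ℝ (Fin 3)) (s : ℝ) :
    ∫⁻ x, ‖curl (nsRescale c u s) x‖ₑ ^ 3 =
      ENNReal.ofReal (c ^ 3) * ∫⁻ y, ‖curl (u (c ^ 2 * s)) y‖ₑ ^ 3 := by
  have hc0 : c ≠ 0 := hc.ne'
  have e1 : ∀ x, ‖curl (nsRescale c u s) x‖ₑ ^ 3 =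
      ENNReal.ofReal (c ^ 6) * ‖curl (u (c ^ 2 * s)) (c • x)‖ₑ ^ 3 := by
    intro x
    rw [QuietVorticity.curl_nsRescale, enorm_smul, mul_pow]
    congr 1
    rw [Real.enorm_eq_ofReal (by positivity), ← ENNReal.ofReal_pow (by positivity)]
    congr 1
    ring
  simp_rw [e1]
  rw [lintegral_const_mul' _ _ ENNReal.ofReal_ne_top]
  have h2 := PoincareBall.lintegral_comp_smul_add
    (fun y : EuclideanSpace ℝ (Fin 3) => ‖curl (u (c ^ 2 * s)) y‖ₑ ^ 3) hc0 0
  simp only [add_zero] at h2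
  rw [h2, ← mul_assoc, finrank_euclideanSpace, Fintype.card_fin]
  congr 1
  rw [← ENNReal.ofReal_mul (by positivity)]
  congr 1
  rw [abs_of_pos (by positivity)]
  field_simp

/-- **The `L³`-vorticity law is scale invariant**: if `∫⁻‖curl u(t)‖ₑ³ ≤ v³/(√(−t))³` at the time
`t = c²s` (`c > 0`, `s < 0`), then `∫⁻‖curl u_c(s)‖ₑ³ ≤ v³/(√(−s))³` (`c³·v³/(c√(−s))³ = v³/(√(−s))³`).
[folklore] -/
theorem cubeLaw_nsRescale {v : ℝ}
    {u : ℝ → EuclideanSpace ℝ (Fin 3) → EuclideanSpace ℝ (Fin 3)} {c : ℝ} (hc : 0 < c)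
    {s : ℝ} (hs : s < 0)
    (hlaw : ∫⁻ x, ‖curl (u (c ^ 2 * s)) x‖ₑ ^ 3 ≤
      ENNReal.ofReal (v ^ 3 / Real.sqrt (-(c ^ 2 * s)) ^ 3)) :
    ∫⁻ x, ‖curl (nsRescale c u s) x‖ₑ ^ 3 ≤ ENNReal.ofReal (v ^ 3 / Real.sqrt (-s) ^ 3) := by
  rw [lintegral_curl_nsRescale_cube hc]
  calc ENNReal.ofReal (c ^ 3) * ∫⁻ y, ‖curl (u (c ^ 2 * s)) y‖ₑ ^ 3
      ≤ ENNReal.ofReal (c ^ 3) * ENNReal.ofReal (v ^ 3 / Real.sqrt (-(c ^ 2 * s)) ^ 3) := by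
        gcongr
    _ = ENNReal.ofReal (v ^ 3 / Real.sqrt (-s) ^ 3) := by
        rw [← ENNReal.ofReal_mul (by positivity)]
        congr 1
        have hsq : Real.sqrt (-(c ^ 2 * s)) = c * Real.sqrt (-s) := by
          rw [show -(c ^ 2 * s) = c ^ 2 * (-s) by ring, Real.sqrt_mul' _ (neg_nonneg.2 hs.le),
            Real.sqrt_sq hc.le]
        rw [hsq, mul_pow]
        have hs' : 0 < Real.sqrt (-s) := Real.sqrt_pos.2 (neg_pos.2 hs)
        field_simp

/-! ### The window form of the `L³`-vorticity rung -/

/-- **The `L³`-vorticity law on long windows forces apex regularity.** If `u ∈ 𝒟_{C,K}`, `v ≥ 0`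
with `KS²v² < 3`, and for every `Λ > 1` there is `τ < 0` with `∫⁻‖curl u(t)‖ₑ³ ≤ v³/(√(−t))³` for
all `t ∈ [Λ²τ, τ/Λ²]`, then `u` is bounded on some backward cylinder at the origin: the orbit limit
along the window scales (`Compactness.seqLimit`) lies in `𝒟_{C,K}` (`law_of_seqLimit`), carries the
`L³` law for ALL `t < 0` (pointwise convergence of the gradients + Fatou) and is singular by
persistence — excluded by `not_singular_of_vorticityLThree_lt`. [cite: KochNadirashviliSereginSverak2009, §4 (arXiv:0709.3599 p. 8)] -/
theorem notSingular_of_vorticityLThree_le_windows {C K : ℝ}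
    {u : ℝ → EuclideanSpace ℝ (Fin 3) → EuclideanSpace ℝ (Fin 3)} (hu : IsTypeIAncientMild C u)
    (hlaw : ∀ s : ℝ, s < 0 → ∫⁻ x, ‖fderiv ℝ (u s) x‖ₑ ^ 2 ≤ ENNReal.ofReal (K / Real.sqrt (-s)))
    {v : ℝ} (hv0 : 0 ≤ v)
    (hv : (SNormLESNormFDerivOfEqConst (EuclideanSpace ℝ (Fin 3))
        (volume : Measure (EuclideanSpace ℝ (Fin 3))) 2 : ℝ) ^ 2 * v ^ 2 < 3)
    (hwin : ∀ Λ : ℝ, 1 < Λ → ∃ τ : ℝ, τ < 0 ∧ ∀ t ∈ Set.Icc (Λ ^ 2 * τ) (τ / Λ ^ 2),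
      ∫⁻ x, ‖curl (u t) x‖ₑ ^ 3 ≤ ENNReal.ofReal (v ^ 3 / Real.sqrt (-t) ^ 3)) :
    ¬ (∀ r > 0, ∀ M : ℝ, ∃ t ∈ Set.Ioo (-(r ^ 2)) (0 : ℝ),
        ∃ x ∈ Metric.ball (0 : EuclideanSpace ℝ (Fin 3)) r, M < ‖u t x‖) := by
  intro hsing
  -- windows at `Λ_k = k + 2`, scales `l_k = √(-τ_k)`
  have hΛ : ∀ k : ℕ, (1 : ℝ) < (k : ℝ) + 2 := fun k => by
    have : (0 : ℝ) ≤ k := Nat.cast_nonneg k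
    linarith
  choose τ hτ hτwin using fun k : ℕ => hwin ((k : ℝ) + 2) (hΛ k)
  set l : ℕ → ℝ := fun k => Real.sqrt (-τ k) with hl_def
  have hl : ∀ k, 0 < l k := fun k => Real.sqrt_pos.2 (neg_pos.2 (hτ k))
  have hl2 : ∀ k, l k ^ 2 = -τ k := fun k => Real.sq_sqrt (neg_pos.2 (hτ k)).le
  -- the rescaled members
  set w : ℕ → ℝ → EuclideanSpace ℝ (Fin 3) → EuclideanSpace ℝ (Fin 3) := fun k => nsRescale (l k) u
    with hwdef
  have hw : ∀ k, IsTypeIAncientMild C (w k) := fun k => hu.nsRescale (hl k)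
  have hwlaw : ∀ k, ∀ s : ℝ, s < 0 →
      ∫⁻ x, ‖fderiv ℝ (w k s) x‖ₑ ^ 2 ≤ ENNReal.ofReal (K / Real.sqrt (-s)) := fun k =>
    RecurrentReductionD.dissipationLaw_nsRescale hlaw (hl k)
  have hwsing : ∀ k, ∀ r > 0, ∀ M : ℝ, ∃ t ∈ Ioo (-(r ^ 2)) (0 : ℝ),
      ∃ x ∈ ball (0 : EuclideanSpace ℝ (Fin 3)) r, M < ‖w k t x‖ := fun k =>
    RecurrentReductionD.singularAtOrigin_nsRescale hsing (hl k)
  -- the rescaled `L³` law, eventually for every fixed `s < 0`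
  have hev : ∀ s : ℝ, s < 0 → ∀ᶠ k : ℕ in atTop,
      ∫⁻ x, ‖curl (w k s) x‖ₑ ^ 3 ≤ ENNReal.ofReal (v ^ 3 / Real.sqrt (-s) ^ 3) := by
    intro s hs
    have hT : Tendsto (fun k : ℕ => ((k : ℝ) + 2) ^ 2) atTop atTop :=
      (tendsto_pow_atTop two_ne_zero).comp
        (tendsto_atTop_add_const_right atTop (2 : ℝ) tendsto_natCast_atTop_atTop)
    filter_upwards [hT.eventually_ge_atTop (-s), hT.eventually_ge_atTop (-s⁻¹)] with k h1 h2
    have hτ' : 0 < -τ k := neg_pos.2 (hτ k)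
    have hs' : 0 < -s := neg_pos.2 hs
    -- the rescaled time `l_k² s` lies in the `k`-th window
    have hmem : l k ^ 2 * s ∈ Set.Icc (((k : ℝ) + 2) ^ 2 * τ k) (τ k / ((k : ℝ) + 2) ^ 2) := by
      rw [hl2 k]
      refine ⟨by nlinarith, ?_⟩
      have hΛ2 : (0 : ℝ) < ((k : ℝ) + 2) ^ 2 := by positivity
      rw [le_div_iff₀ hΛ2]
      have h3 : 1 ≤ (-s) * ((k : ℝ) + 2) ^ 2 := by
        have := mul_le_mul_of_nonneg_left h2 hs'.le
        rwa [show (-s) * (-s⁻¹) = 1 by rw [neg_mul_neg, mul_inv_cancel₀ hs.ne]] at this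
      nlinarith
    exact cubeLaw_nsRescale (hl k) hs (hτwin k (l k ^ 2 * s) hmem)
  -- KNSS limit along the scales: a member of `𝒟_{C,K}`, singular, with the `L³` law for ALL `t`
  obtain ⟨ψ, hψ, W, hW, hunif, hpt, hgrad⟩ := Compactness.seqLimit hw
  have hψt : Tendsto ψ atTop atTop := hψ.tendsto_atTop
  have hWlaw : ∀ s : ℝ, s < 0 →
      ∫⁻ x, ‖fderiv ℝ (W s) x‖ₑ ^ 2 ≤ ENNReal.ofReal (K / Real.sqrt (-s)) :=
    Compactness.law_of_seqLimit (Kk := fun _ => K) (Kinf := K) hψt hwlaw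
      (fun ε hε => Eventually.of_forall fun k => by linarith) hgrad
  have hWsing := Compactness.persistent_singularity_seq (w := fun j => w (ψ j))
    (fun j => hw _) (fun j => hwlaw _) (fun j => hwsing _) hW hunif
  have hW3 : ∀ s : ℝ, s < 0 →
      ∫⁻ y, ‖curl (W s) y‖ₑ ^ 3 ≤ ENNReal.ofReal (v ^ 3 / Real.sqrt (-s) ^ 3) := by
    intro s hs
    -- pointwise convergence of the integrands
    have hptw : ∀ y, Tendsto (fun j => ‖curl (w (ψ j) s) y‖ₑ ^ 3) atTop
        (𝓝 (‖curl (W s) y‖ₑ ^ 3)) := by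
      intro y
      have hc : Tendsto (fun j => curl (w (ψ j) s) y) atTop (𝓝 (curl (W s) y)) := by
        simp only [curl_eq_curlCLM]
        exact (curlCLM.continuous.tendsto _).comp (hgrad s hs y)
      exact ((ENNReal.continuous_pow 3).tendsto _).comp ((continuous_enorm.tendsto _).comp hc)
    -- measurability of the integrands (continuous slices)
    have hmeas : ∀ j, AEMeasurable (fun y => ‖curl (w (ψ j) s) y‖ₑ ^ 3) volume := by
      intro j
      have h1 : ContDiff ℝ 1 (w (ψ j) s) := ((hw (ψ j)).contDiff_slice hs).of_le (by norm_cast)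
      have hcont : Continuous (curl (w (ψ j) s)) := by
        rw [curl_eq_curlCLM_comp]
        exact curlCLM.continuous.comp (h1.continuous_fderiv one_ne_zero)
      exact ((ENNReal.continuous_pow 3).comp hcont.enorm).aemeasurable
    -- Fatou
    calc ∫⁻ y, ‖curl (W s) y‖ₑ ^ 3
        = ∫⁻ y, liminf (fun j => ‖curl (w (ψ j) s) y‖ₑ ^ 3) atTop :=
          lintegral_congr fun y => ((hptw y).liminf_eq).symm
      _ ≤ liminf (fun j => ∫⁻ y, ‖curl (w (ψ j) s) y‖ₑ ^ 3) atTop := lintegral_liminf_le' hmeas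
      _ ≤ liminf (fun _ : ℕ => ENNReal.ofReal (v ^ 3 / Real.sqrt (-s) ^ 3)) atTop :=
          liminf_le_liminf (hψt.eventually (hev s hs))
      _ = ENNReal.ofReal (v ^ 3 / Real.sqrt (-s) ^ 3) := liminf_const _
  exact not_singular_of_vorticityLThree_lt hW hWlaw hv0 hv hW3 hWsing

/-- **A singular finite-dissipation profile carries `L³`-vorticity `≥ √3/KS` (scale-invariantly) in
every long log-window**: for `u` a SINGULAR member of `𝒟_{C,K}` and every `v ≥ 0` with `KS²v² < 3`
there is `Λ > 1` such that every backward window `[Λ²τ, τ/Λ²]` (`τ < 0`) contains an instant `t` with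
`∫⁻‖curl u(t)‖ₑ³ > v³/(√(−t))³`, i.e. `√(−t)‖curl u(t)‖_{L³} > v`. No compactness constant.
[cite: KochNadirashviliSereginSverak2009, §4 (arXiv:0709.3599 p. 8)] -/
theorem vorticityLThree_exceeds_windows_of_singular {C K : ℝ}
    {u : ℝ → EuclideanSpace ℝ (Fin 3) → EuclideanSpace ℝ (Fin 3)} (hu : IsTypeIAncientMild C u)
    (hlaw : ∀ s : ℝ, s < 0 → ∫⁻ x, ‖fderiv ℝ (u s) x‖ₑ ^ 2 ≤ ENNReal.ofReal (K / Real.sqrt (-s)))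
    (hsing : ∀ r > 0, ∀ M : ℝ, ∃ t ∈ Set.Ioo (-(r ^ 2)) (0 : ℝ),
        ∃ x ∈ Metric.ball (0 : EuclideanSpace ℝ (Fin 3)) r, M < ‖u t x‖)
    {v : ℝ} (hv0 : 0 ≤ v)
    (hv : (SNormLESNormFDerivOfEqConst (EuclideanSpace ℝ (Fin 3))
        (volume : Measure (EuclideanSpace ℝ (Fin 3))) 2 : ℝ) ^ 2 * v ^ 2 < 3) :
    ∃ Λ : ℝ, 1 < Λ ∧ ∀ τ : ℝ, τ < 0 →
      ∃ t ∈ Set.Icc (Λ ^ 2 * τ) (τ / Λ ^ 2),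
        ENNReal.ofReal (v ^ 3 / Real.sqrt (-t) ^ 3) < ∫⁻ x, ‖curl (u t) x‖ₑ ^ 3 := by
  by_contra hcon
  push Not at hcon
  exact notSingular_of_vorticityLThree_le_windows hu hlaw hv0 hv hcon hsing

/-- **Far past**: a singular member of `𝒟_{C,K}` has, for every `v ≥ 0` with `KS²v² < 3` and every
`T < 0`, an instant `t ≤ T` with `∫⁻‖curl u(t)‖ₑ³ > v³/(√(−t))³`
(`limsup_{t→−∞} √(−t)‖curl u(t)‖_{L³} ≥ √3/KS`). [folklore] -/
theorem vorticityLThree_exceeds_farPast_of_singular {C K : ℝ}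
    {u : ℝ → EuclideanSpace ℝ (Fin 3) → EuclideanSpace ℝ (Fin 3)} (hu : IsTypeIAncientMild C u)
    (hlaw : ∀ s : ℝ, s < 0 → ∫⁻ x, ‖fderiv ℝ (u s) x‖ₑ ^ 2 ≤ ENNReal.ofReal (K / Real.sqrt (-s)))
    (hsing : ∀ r > 0, ∀ M : ℝ, ∃ t ∈ Set.Ioo (-(r ^ 2)) (0 : ℝ),
        ∃ x ∈ Metric.ball (0 : EuclideanSpace ℝ (Fin 3)) r, M < ‖u t x‖)
    {v : ℝ} (hv0 : 0 ≤ v)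
    (hv : (SNormLESNormFDerivOfEqConst (EuclideanSpace ℝ (Fin 3))
        (volume : Measure (EuclideanSpace ℝ (Fin 3))) 2 : ℝ) ^ 2 * v ^ 2 < 3)
    (T : ℝ) (hT : T < 0) :
    ∃ t : ℝ, t ≤ T ∧ ENNReal.ofReal (v ^ 3 / Real.sqrt (-t) ^ 3) < ∫⁻ x, ‖curl (u t) x‖ₑ ^ 3 := by
  obtain ⟨Λ, hΛ, hwin⟩ := vorticityLThree_exceeds_windows_of_singular hu hlaw hsing hv0 hv
  have hΛ2 : (0 : ℝ) < Λ ^ 2 := by positivity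
  obtain ⟨t, ht, hx⟩ := hwin (Λ ^ 2 * T) (mul_neg_of_pos_of_neg hΛ2 hT)
  refine ⟨t, ?_, hx⟩
  have h1 : t ≤ Λ ^ 2 * T / Λ ^ 2 := ht.2
  rwa [mul_div_cancel_left₀ _ (by positivity : Λ ^ 2 ≠ 0)] at h1

/-- **Near the apex**: a singular member of `𝒟_{C,K}` has, for every `v ≥ 0` with `KS²v² < 3` and
every `T < 0`, an instant `T ≤ t < 0` with `∫⁻‖curl u(t)‖ₑ³ > v³/(√(−t))³`
(`limsup_{t→0⁻} √(−t)‖curl u(t)‖_{L³} ≥ √3/KS`): the `L³` blow-up rate of the vorticity of a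
finite-dissipation Type-I singularity carries at least the explicit constant `√3/KS` in the
scale-invariant normalisation. [folklore] -/
theorem vorticityLThree_exceeds_nearApex_of_singular {C K : ℝ}
    {u : ℝ → EuclideanSpace ℝ (Fin 3) → EuclideanSpace ℝ (Fin 3)} (hu : IsTypeIAncientMild C u)
    (hlaw : ∀ s : ℝ, s < 0 → ∫⁻ x, ‖fderiv ℝ (u s) x‖ₑ ^ 2 ≤ ENNReal.ofReal (K / Real.sqrt (-s)))
    (hsing : ∀ r > 0, ∀ M : ℝ, ∃ t ∈ Set.Ioo (-(r ^ 2)) (0 : ℝ),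
        ∃ x ∈ Metric.ball (0 : EuclideanSpace ℝ (Fin 3)) r, M < ‖u t x‖)
    {v : ℝ} (hv0 : 0 ≤ v)
    (hv : (SNormLESNormFDerivOfEqConst (EuclideanSpace ℝ (Fin 3))
        (volume : Measure (EuclideanSpace ℝ (Fin 3))) 2 : ℝ) ^ 2 * v ^ 2 < 3)
    (T : ℝ) (hT : T < 0) :
    ∃ t : ℝ, T ≤ t ∧ t < 0 ∧
      ENNReal.ofReal (v ^ 3 / Real.sqrt (-t) ^ 3) < ∫⁻ x, ‖curl (u t) x‖ₑ ^ 3 := by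
  obtain ⟨Λ, hΛ, hwin⟩ := vorticityLThree_exceeds_windows_of_singular hu hlaw hsing hv0 hv
  have hΛ2 : (0 : ℝ) < Λ ^ 2 := by positivity
  obtain ⟨t, ht, hx⟩ := hwin (T / Λ ^ 2) (div_neg_of_neg_of_pos hT hΛ2)
  refine ⟨t, ?_, ?_, hx⟩
  · have h1 : Λ ^ 2 * (T / Λ ^ 2) ≤ t := ht.1
    rwa [mul_div_cancel₀ _ hΛ2.ne'] at h1
  · have h2 : t ≤ T / Λ ^ 2 / Λ ^ 2 := ht.2
    have h3 : T / Λ ^ 2 / Λ ^ 2 < 0 := div_neg_of_neg_of_pos (div_neg_of_neg_of_pos hT hΛ2) hΛ2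
    linarith

end Summit.NavierStokesRegularity.NavierStokesRegularity.Theorems.FiniteDissipationLiouville.VorticityLThree

end
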